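import Literature.Analysis.FluidPDE.KNSSSwirlLiouville
import Literature.Analysis.FluidPDE.AncientMildWeakStar
import HarnessLib

/-!
# The swirl of the KNSS representative as a member of the local drift–heat class: data

Analysis/FluidPDE **proofs file** (theorems only: no definitions, no named facts, no `sorry`),
infrastructure for the swirl half (ii) of the named fact
`Literature.Analysis.FluidPDE.leiRenZhang2019_sliding` (Lei–Ren–Zhang, arXiv:1902.11229,
Lemma 5.1). The tree's form of KNSS 2009 §4 for an axisymmetric bounded ancient solution
(`KNSS2009_regularity_axisymmetric_swirl`) delivers a representative `U + β(t) e_z` with smooth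
slices, bounds (4.7) `‖∇ᵏU‖ ≤ C_k`, time-Lipschitz bounds (4.8) and the swirl equation (5.10),
integrated in time, with drift `U + β e_z` and the singular term `(2/r)∂ᵣΓ`. This file records
the elementary consequences that place `Γ = swirl (U t)` in the hypotheses of the local
drift–heat class `IsDriftHeatSolutionOn` (`DriftHeatLocalClass`; the class of KNSS Lemma 2.1 and
of the interior Harnack inequality `Lieberman1996_harnack_drift_gap`) away from the axis:

* `continuousOn_fderiv_swirl_of_lipschitz`, `continuousOn_laplacian_swirl_of_lipschitz` —
  joint continuity of `∇Γ`, `ΔΓ` on `(−∞, 0) × ℝ³` from (4.8) for `k ≤ 2`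
  (`fderiv_swirl_apply`, `laplacian_swirl`, `continuousOn_iteratedFDeriv_of_lipschitz`; the
  argument of `KNSS2009_thm53_ae_swirl_free`, extracted);
* `swirl_integrand_eq_drift_form` / `swirl_sub_eq_integral_drift_form` — the integrand of
  (5.10), `ΔΓ − DΓ[U + βe_z] − (2/r)∂ᵣΓ`, is `(ΔΓ − DΓ[b]) − β DΓ[e_z]` with the jointly continuous
  (off the axis) drift `b = U + (2/r)e_r` and the parasitic multiplier `β` separated — the form
  consumed by `isDriftHeatSolutionOn_galilean_rescale` (`DriftHeatGalileanRescale`);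
* `measurable_uncurry_swirlDrift`, `continuousOn_uncurry_swirlDrift` — `b` is jointly measurable,
  and jointly continuous on sets avoiding the axis;

## Mathlib / tree search

Tree: `continuousOn_iteratedFDeriv_of_lipschitz` (`KNSSSwirlLiouville`), `fderiv_swirl_apply`,
`laplacian_swirl`, `rotGenL` (`SwirlTransportProofs`), `cylRadius_le_cylRadius_add_norm_sub`
(`AncientMildWeakStar`), `continuous_cylRadius`, `eR`, `partialDeriv` (`AxisymmetricEuler`,
`VectorCalculus`). Mathlib: `continuousOn_clm_apply`, `ContinuousMultilinearMap.apply`.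

## References

* G. Koch, N. Nadirashvili, G. Seregin, V. Šverák, Acta Math. 203 (2009) = arXiv:0709.3599,
  §4 (4.7)–(4.8) p. 8, proof of Thm 5.3, (5.10) p. 10. [KochNadirashviliSereginSverak2009]
* Z. Lei, X. Ren, Q. S. Zhang, arXiv:1902.11229, proof of Lemma 5.1 (arXiv p. 13).
  [LeiRenZhang2019]
-/

noncomputable section

open MeasureTheory Set Function Filter TopologicalSpace InnerProductSpace Metric WithLp
open _root_.Topology
open scoped RealInnerProductSpace Laplacian ContDiff

namespace Literature.Analysis.FluidPDE

section SwirlData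

variable {U : ℝ → EuclideanSpace ℝ (Fin 3) → EuclideanSpace ℝ (Fin 3)}

/-- Joint continuity of `∇U` and `∇²U` on `(−∞, 0) × ℝ³` from (4.8) for `k = 1, 2`, in the
applied forms `p ↦ DU(p)[y]`, `p ↦ D²U(p)[m]`. [cite: KochNadirashviliSereginSverak2009, §4 (4.8) (arXiv p. 8)] -/
theorem continuousOn_fderiv_apply_of_lipschitz (hsm : ∀ t < 0, ContDiff ℝ ∞ (U t)) {L₁ : ℝ}
    (hL₁ : ∀ s < 0, ∀ t < 0, ∀ x,
      ‖iteratedFDeriv ℝ 1 (U t) x - iteratedFDeriv ℝ 1 (U s) x‖ ≤ L₁ * |t - s|)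
    (y : EuclideanSpace ℝ (Fin 3)) :
    ContinuousOn (fun p : ℝ × EuclideanSpace ℝ (Fin 3) => fderiv ℝ (U p.1) p.2 y)
      (Iio 0 ×ˢ univ) := by
  have h := (ContinuousMultilinearMap.apply ℝ (fun _ : Fin 1 => EuclideanSpace ℝ (Fin 3))
    (EuclideanSpace ℝ (Fin 3)) (fun _ => y)).continuous.comp_continuousOn
    (continuousOn_iteratedFDeriv_of_lipschitz hsm hL₁)
  refine h.congr fun p _ => ?_
  simp only [comp_apply, ContinuousMultilinearMap.apply_apply, iteratedFDeriv_one_apply]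

/-- **Joint continuity of `∇Γ`** for `Γ = swirl (U t)`: `DΓ(x)[y] = ⟪Jx, DU(x)y⟫ + ⟪Jy, U(x)⟫`
with `U`, `∇U` jointly continuous by (4.8). [cite: KochNadirashviliSereginSverak2009, §4 (4.8) (arXiv p. 8) and (5.10) p. 10] -/
theorem continuousOn_fderiv_swirl_of_lipschitz (hsm : ∀ t < 0, ContDiff ℝ ∞ (U t)) {L₀ L₁ : ℝ}
    (hL₀ : ∀ s < 0, ∀ t < 0, ∀ x,
      ‖iteratedFDeriv ℝ 0 (U t) x - iteratedFDeriv ℝ 0 (U s) x‖ ≤ L₀ * |t - s|)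
    (hL₁ : ∀ s < 0, ∀ t < 0, ∀ x,
      ‖iteratedFDeriv ℝ 1 (U t) x - iteratedFDeriv ℝ 1 (U s) x‖ ≤ L₁ * |t - s|) :
    ContinuousOn (fun p : ℝ × EuclideanSpace ℝ (Fin 3) => fderiv ℝ (swirl (U p.1)) p.2)
      (Iio 0 ×ˢ univ) := by
  have hUd : ∀ t < 0, ∀ x, DifferentiableAt ℝ (U t) x := fun t ht x =>
    (((hsm t ht).of_le (by norm_cast)).differentiable one_ne_zero) x
  have hUc : ContinuousOn (fun p : ℝ × EuclideanSpace ℝ (Fin 3) => U p.1 p.2) (Iio 0 ×ˢ univ) := by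
    have h := (ContinuousMultilinearMap.apply ℝ (fun _ : Fin 0 => EuclideanSpace ℝ (Fin 3))
      (EuclideanSpace ℝ (Fin 3)) (Fin.elim0 : Fin 0 → EuclideanSpace ℝ (Fin 3))).continuous.comp_continuousOn
      (continuousOn_iteratedFDeriv_of_lipschitz hsm hL₀)
    refine h.congr fun p _ => ?_
    simp only [comp_apply, ContinuousMultilinearMap.apply_apply, iteratedFDeriv_zero_apply]
  refine continuousOn_clm_apply.2 fun y => ?_
  have hG : ContinuousOn (fun p : ℝ × EuclideanSpace ℝ (Fin 3) =>
      ⟪rotGen p.2, fderiv ℝ (U p.1) p.2 y⟫ + ⟪rotGen y, U p.1 p.2⟫) (Iio 0 ×ˢ univ) :=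
    ((rotGenL.continuous.comp continuous_snd).continuousOn.inner
      (continuousOn_fderiv_apply_of_lipschitz hsm hL₁ y)).add (continuousOn_const.inner hUc)
  refine hG.congr fun p hp => ?_
  exact fderiv_swirl_apply (hUd p.1 hp.1 p.2) y

/-- **Joint continuity of `ΔΓ`** for `Γ = swirl (U t)`: `ΔΓ = ⟪Jx, ΔU⟫ + 2(∂₀U₁ − ∂₁U₀)`,
`ΔU = Σᵢ D²U[eᵢ, eᵢ]`, with `∇U`, `∇²U` jointly continuous by (4.8). [cite: KochNadirashviliSereginSverak2009, §4 (4.8) (arXiv p. 8) and (5.10) p. 10] -/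
theorem continuousOn_laplacian_swirl_of_lipschitz (hsm : ∀ t < 0, ContDiff ℝ ∞ (U t)) {L₁ L₂ : ℝ}
    (hL₁ : ∀ s < 0, ∀ t < 0, ∀ x,
      ‖iteratedFDeriv ℝ 1 (U t) x - iteratedFDeriv ℝ 1 (U s) x‖ ≤ L₁ * |t - s|)
    (hL₂ : ∀ s < 0, ∀ t < 0, ∀ x,
      ‖iteratedFDeriv ℝ 2 (U t) x - iteratedFDeriv ℝ 2 (U s) x‖ ≤ L₂ * |t - s|) :
    ContinuousOn (fun p : ℝ × EuclideanSpace ℝ (Fin 3) => (Δ (swirl (U p.1))) p.2)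
      (Iio 0 ×ˢ univ) := by
  classical
  have hU2 : ∀ t < 0, ContDiff ℝ 2 (U t) := fun t ht => (hsm t ht).of_le (by norm_cast)
  have hD2c : ∀ m : Fin 2 → EuclideanSpace ℝ (Fin 3),
      ContinuousOn (fun p : ℝ × EuclideanSpace ℝ (Fin 3) => iteratedFDeriv ℝ 2 (U p.1) p.2 m)
        (Iio 0 ×ˢ univ) := fun m =>
    (ContinuousMultilinearMap.apply ℝ (fun _ : Fin 2 => EuclideanSpace ℝ (Fin 3))
      (EuclideanSpace ℝ (Fin 3)) m).continuous.comp_continuousOn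
      (continuousOn_iteratedFDeriv_of_lipschitz hsm hL₂)
  set b := EuclideanSpace.basisFun (Fin 3) ℝ with hb
  have hΔU : ContinuousOn (fun p : ℝ × EuclideanSpace ℝ (Fin 3) => (Δ (U p.1)) p.2)
      (Iio 0 ×ˢ univ) := by
    have h : ContinuousOn
        (fun p : ℝ × EuclideanSpace ℝ (Fin 3) => ∑ i, iteratedFDeriv ℝ 2 (U p.1) p.2 ![b i, b i])
        (Iio 0 ×ˢ univ) :=
      continuousOn_finsetSum _ fun i _ => hD2c _
    refine h.congr fun p _ => ?_
    exact congrFun (laplacian_eq_iteratedFDeriv_orthonormalBasis (U p.1) b) p.2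
  have hG : ContinuousOn (fun p : ℝ × EuclideanSpace ℝ (Fin 3) => ⟪rotGen p.2, (Δ (U p.1)) p.2⟫ +
      2 * (fderiv ℝ (U p.1) p.2 (EuclideanSpace.single 0 1) 1 -
        fderiv ℝ (U p.1) p.2 (EuclideanSpace.single 1 1) 0)) (Iio 0 ×ˢ univ) :=
    ((rotGenL.continuous.comp continuous_snd).continuousOn.inner hΔU).add
      (continuousOn_const.mul
        (((PiLp.continuous_apply 2 _ 1).comp_continuousOn
          (continuousOn_fderiv_apply_of_lipschitz hsm hL₁ _)).sub
          ((PiLp.continuous_apply 2 _ 0).comp_continuousOn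
            (continuousOn_fderiv_apply_of_lipschitz hsm hL₁ _))))
  refine hG.congr fun p hp => ?_
  exact laplacian_swirl (hU2 p.1 hp.1) p.2

/-! ### The swirl equation with the parasitic multiplier separated -/

/-- The integrand of KNSS (5.10) in drift form:
`ΔΓ − DΓ[u + β e_z] − (2/r)∂ᵣΓ = (ΔΓ − DΓ[u + (2/r)e_r]) − β DΓ[e_z]`. [cite: KochNadirashviliSereginSverak2009, proof of Thm 5.3, (5.10) (arXiv p. 10)] -/
theorem swirl_integrand_eq_drift_form (f : EuclideanSpace ℝ (Fin 3) → ℝ)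
    (u : EuclideanSpace ℝ (Fin 3)) (β' : ℝ) (x : EuclideanSpace ℝ (Fin 3)) :
    (Δ f) x - fderiv ℝ f x (u + β' • eZ) - 2 / cylRadius x * partialDeriv (eR x) f x =
      ((Δ f) x - fderiv ℝ f x (u + (2 / cylRadius x) • eR x)) - β' * fderiv ℝ f x eZ := by
  simp only [partialDeriv, map_add, map_smul, smul_eq_mul]
  ring

/-- **The integrated swirl equation (5.10) in drift form**: off the axis,
`Γ(t, x) − Γ(s, x) = ∫ₛᵗ ((ΔΓ − DΓ[U + (2/r)e_r]) − β DΓ[e_z])(τ, x) dτ`. [cite: KochNadirashviliSereginSverak2009, proof of Thm 5.3, (5.10) (arXiv p. 10)] -/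
theorem swirl_sub_eq_integral_drift_form {β : ℝ → ℝ}
    (hswirlEq : ∀ x, cylRadius x ≠ 0 → ∀ s t : ℝ, s ≤ t → t < 0 →
      swirl (U t) x - swirl (U s) x =
        ∫ τ in s..t, ((Δ (swirl (U τ))) x - fderiv ℝ (swirl (U τ)) x (U τ x + β τ • eZ) -
          2 / cylRadius x * partialDeriv (eR x) (swirl (U τ)) x))
    {x : EuclideanSpace ℝ (Fin 3)} (hx : cylRadius x ≠ 0) {s t : ℝ} (hst : s ≤ t) (ht : t < 0) :
    swirl (U t) x - swirl (U s) x =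
      ∫ τ in s..t, (((Δ (swirl (U τ))) x -
        fderiv ℝ (swirl (U τ)) x (U τ x + (2 / cylRadius x) • eR x)) -
        β τ * fderiv ℝ (swirl (U τ)) x eZ) := by
  rw [hswirlEq x hx s t hst ht]
  refine intervalIntegral.integral_congr fun τ _ => ?_
  exact swirl_integrand_eq_drift_form _ _ _ _

/-! ### The drift `b = U + (2/r) e_r` -/

/-- The horizontal projection `x ↦ (x₀, x₁, 0)` is continuous. [folklore] -/
private theorem continuous_horizontal_aux :
    Continuous fun x : EuclideanSpace ℝ (Fin 3) =>
      (toLp 2 ![x 0, x 1, 0] : EuclideanSpace ℝ (Fin 3)) := by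
  fun_prop

/-- `e_r` is measurable (continuous data, junk value `0` on the axis from `0⁻¹ = 0`). [folklore] -/
private theorem measurable_eR_aux :
    Measurable (eR : EuclideanSpace ℝ (Fin 3) → EuclideanSpace ℝ (Fin 3)) :=
  continuous_cylRadius.measurable.inv.smul continuous_horizontal_aux.measurable

/-- `e_r` is continuous off the axis. [folklore] -/
private theorem continuousOn_eR_aux :
    ContinuousOn (eR : EuclideanSpace ℝ (Fin 3) → EuclideanSpace ℝ (Fin 3))
      {y | cylRadius y ≠ 0} :=
  (continuous_cylRadius.continuousOn.inv₀ fun _ hy => hy).smul continuous_horizontal_aux.continuousOn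

/-- **The drift `b(t, x) = U(t, x) + (2/r(x)) e_r(x)` is jointly measurable** for a jointly
measurable `U`. [cite: KochNadirashviliSereginSverak2009, proof of Thm 5.3, (5.10) (arXiv p. 10)] -/
theorem measurable_uncurry_swirlDrift (hUm : Measurable (uncurry U)) :
    Measurable (uncurry fun t (x : EuclideanSpace ℝ (Fin 3)) =>
      U t x + (2 / cylRadius x) • eR x) := by
  have h2 : Measurable fun p : ℝ × EuclideanSpace ℝ (Fin 3) => (2 / cylRadius p.2) • eR p.2 :=
    ((measurable_const.div (continuous_cylRadius.measurable.comp measurable_snd))).smul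
      (measurable_eR_aux.comp measurable_snd)
  exact hUm.add h2

/-- **The drift `b = U + (2/r) e_r` is jointly continuous on sets avoiding the axis** when `U`
is jointly continuous. [cite: KochNadirashviliSereginSverak2009, proof of Thm 5.3, (5.10) (arXiv p. 10)] -/
theorem continuousOn_uncurry_swirlDrift {S : Set ℝ} {V : Set (EuclideanSpace ℝ (Fin 3))}
    (hUc : ContinuousOn (uncurry U) (S ×ˢ univ)) (hV : ∀ x ∈ V, cylRadius x ≠ 0) :
    ContinuousOn (uncurry fun t (x : EuclideanSpace ℝ (Fin 3)) =>
      U t x + (2 / cylRadius x) • eR x) (S ×ˢ V) := by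
  have h1 : ContinuousOn (uncurry U) (S ×ˢ V) := hUc.mono (prod_mono Subset.rfl (subset_univ _))
  have h2 : ContinuousOn (fun p : ℝ × EuclideanSpace ℝ (Fin 3) => (2 / cylRadius p.2) • eR p.2)
      (S ×ˢ V) := by
    have hmaps : MapsTo (fun p : ℝ × EuclideanSpace ℝ (Fin 3) => p.2) (S ×ˢ V)
        {y | cylRadius y ≠ 0} := fun p hp => hV p.2 hp.2
    have hsc : ContinuousOn (fun p : ℝ × EuclideanSpace ℝ (Fin 3) => 2 / cylRadius p.2) (S ×ˢ V) :=
      continuousOn_const.div (continuous_cylRadius.comp_continuousOn continuous_snd.continuousOn)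
        fun p hp => hV p.2 hp.2
    exact hsc.smul (continuousOn_eR_aux.comp continuous_snd.continuousOn hmaps)
  exact h1.add h2

end SwirlData

end Literature.Analysis.FluidPDE

end
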